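import Literature.NumberTheory.Transcendental.RoySmallValueInterpolationIso
import Mathlib.RingTheory.Ideal.Span
import HarnessLib

/-!
# Roy's small value estimate for `𝔾ₐ × 𝔾ₘ` — Lemma 5.1 for `m = 2`: degrees of `(P)`, `(P, Q)` and monomial complements

Topic `Literature/NumberTheory/Transcendental`. Part of the formalisation of the proof of Roy 2013,
Theorem 1.1 (named fact `roy2013_thm_1_1`, `RoySmallValueEstimates.lean`). Source: D. Roy,
*A small value estimate for `𝔾ₐ × 𝔾ₘ`*, Mathematika 59 (2013) 333–363 = arXiv:1301.0663, §5,
Lemma 5.1 (p. 13 of the arXiv text):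

> **Lemma 5.1.** Let `P₀, …, P_m` be a regular sequence of `ℂ[X]` contained in `ℂ[X]_D`, and
> `ν ≥ (m+1)D - m`. Then there exist subspaces `E₀, …, E_m` of `ℂ[X]_{ν-D}` with
> `dim E_m = D^m` such that `ℂ[X]_ν = E₀P₀ ⊕ ⋯ ⊕ E_mP_m`.

This file provides the Hilbert-function bookkeeping of the printed proof in the case `m = 2`,
`ν = 3D` (any fixed `ν ≥ 3D - 2` serves in §6; `ν = 3D` keeps all degrees non-negative):

* `homogeneousComponent_mul_right` — `(aP)_{n+D} = a_n P` for `P ∈ ℂ[X]_D`;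
* `mem_map_mulLeft_of_mem_span_singleton`, `mem_sup_of_mem_span_pair` — the degree-`m` parts
  `(P)_m = P·ℂ[X]_{m-D}` and `(P,Q)_m = P·ℂ[X]_{m-D} + Q·ℂ[X]_{m-D}`;
* `finrank_map_mulLeft` — `dim P·ℂ[X]_n = dim ℂ[X]_n`; `finrank_span_P_sup_span_Q` —
  `dim (P,Q)_{2D} = 2 dim ℂ[X]_D - 1` when `Q` is a non-zero-divisor modulo `(P)` (the exact
  sequence (5.1) of the paper in degree `2D`);
* `exists_monomial_complement` — every subspace of `ℂ[X]_n` has a complement spanned by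
  monomials (so that the matrices of §5 have integer entries in the coefficients).

The direct sum decomposition itself (with `dim E₂ = D²`) is in the sequel. Everything here is
proved; no new named facts.

## References

* [Roy2013] D. Roy, *A small value estimate for 𝔾ₐ × 𝔾ₘ*, Mathematika 59 (2013), 333–363
  (arXiv:1301.0663), §5, Lemma 5.1.
-/

noncomputable section

open MvPolynomial Finset Module

namespace Literature.NumberTheory.Transcendental

namespace Roy2013

/-! ### Homogeneous components of `a · P` -/

/-- `(aP)_{n+D} = a_n · P` for a form `P` of degree `D`. [folklore] -/
theorem homogeneousComponent_mul_right {a P : CX} {D : ℕ} (hP : P.IsHomogeneous D) (n : ℕ) :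
    homogeneousComponent (n + D) (a * P) = homogeneousComponent n a * P := by
  classical
  conv_lhs => rw [← sum_homogeneousComponent a, Finset.sum_mul, map_sum]
  have hterm : ∀ i ∈ range (a.totalDegree + 1),
      homogeneousComponent (n + D) (homogeneousComponent i a * P) =
        if i = n then homogeneousComponent n a * P else 0 := by
    intro i _
    rw [homogeneousComponent_of_mem ((homogeneousComponent_isHomogeneous i a).mul hP)]
    by_cases hin : i = n
    · subst hin; simp
    · rw [if_neg (by omega), if_neg hin]
  rw [Finset.sum_congr rfl hterm, Finset.sum_ite_eq']
  split_ifs with h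
  · rfl
  · rw [mem_range, not_lt] at h
    rw [homogeneousComponent_eq_zero _ _ (by omega), zero_mul]

/-! ### The degree-`m` part of `(P)` and of `(P, Q)` -/

/-- **`(P)_m = P · ℂ[X]_{m-D}`**: a form of degree `m ≥ D` in the ideal `(P)` (`P ∈ ℂ[X]_D`) is
`P` times a form of degree `m - D`. [cite: Roy2013, §5, proof of Lemma 5.1] -/
theorem mem_map_mulLeft_of_mem_span_singleton {P f : CX} {D m : ℕ} (hP : P.IsHomogeneous D)
    (hDm : D ≤ m) (hf : f.IsHomogeneous m) (hfP : f ∈ Ideal.span {P}) :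
    f ∈ (homogeneousSubmodule (Fin 3) ℂ (m - D)).map (LinearMap.mulLeft ℂ P) := by
  obtain ⟨a, rfl⟩ := Ideal.mem_span_singleton'.mp hfP
  refine ⟨homogeneousComponent (m - D) a, homogeneousComponent_isHomogeneous _ _, ?_⟩
  rw [LinearMap.mulLeft_apply, mul_comm, ← homogeneousComponent_mul_right hP,
    Nat.sub_add_cancel hDm, homogeneousComponent_of_mem hf, if_pos rfl]

/-- **`(P, Q)_m = P · ℂ[X]_{m-D} + Q · ℂ[X]_{m-D}`** for forms `P, Q ∈ ℂ[X]_D`, `m ≥ D`.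
[cite: Roy2013, §5, proof of Lemma 5.1] -/
theorem mem_sup_of_mem_span_pair {P Q f : CX} {D m : ℕ} (hP : P.IsHomogeneous D)
    (hQ : Q.IsHomogeneous D) (hDm : D ≤ m) (hf : f.IsHomogeneous m) (hfPQ : f ∈ Ideal.span {P, Q}) :
    f ∈ (homogeneousSubmodule (Fin 3) ℂ (m - D)).map (LinearMap.mulLeft ℂ P) ⊔
      (homogeneousSubmodule (Fin 3) ℂ (m - D)).map (LinearMap.mulLeft ℂ Q) := by
  obtain ⟨a, b, rfl⟩ := Ideal.mem_span_pair.mp hfPQ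
  have h : a * P + b * Q = homogeneousComponent (m - D) a * P + homogeneousComponent (m - D) b * Q := by
    conv_lhs => rw [← if_pos rfl (t := a * P + b * Q), ← homogeneousComponent_of_mem hf, map_add,
      ← Nat.sub_add_cancel hDm, homogeneousComponent_mul_right hP, homogeneousComponent_mul_right hQ]
  rw [h]
  exact Submodule.add_mem_sup ⟨_, homogeneousComponent_isHomogeneous _ _, by
      rw [LinearMap.mulLeft_apply, mul_comm]⟩
    ⟨_, homogeneousComponent_isHomogeneous _ _, by rw [LinearMap.mulLeft_apply, mul_comm]⟩

/-! ### Dimensions -/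

/-- `P · ℂ[X]_n ⊆ ℂ[X]_{n+D}`. [folklore] -/
theorem map_mulLeft_le {P : CX} {D : ℕ} (hP : P.IsHomogeneous D) (n : ℕ) :
    (homogeneousSubmodule (Fin 3) ℂ n).map (LinearMap.mulLeft ℂ P) ≤
      homogeneousSubmodule (Fin 3) ℂ (n + D) := by
  rintro _ ⟨a, ha, rfl⟩
  rw [LinearMap.mulLeft_apply, add_comm]
  exact hP.mul ha

/-- **`dim P · ℂ[X]_n = binom(n+2, 2)`** for `P ≠ 0` (multiplication by `P` is injective).
[cite: Roy2013, §5, proof of Lemma 5.1] -/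
theorem finrank_map_mulLeft {P : CX} (hP0 : P ≠ 0) (n : ℕ) :
    finrank ℂ ((homogeneousSubmodule (Fin 3) ℂ n).map (LinearMap.mulLeft ℂ P)) = (n + 2).choose 2 := by
  rw [← finrank_homogeneousSubmodule_fin_three n]
  exact (LinearEquiv.finrank_eq (Submodule.equivMapOfInjective _
    (mul_right_injective₀ hP0) _)).symm

/-- `(P)_D ∩ Q·ℂ[X]_0`-type computation: **`P·ℂ[X]_D ∩ Q·ℂ[X]_D = ℂ · PQ`** when `Q` is a
non-zero-divisor modulo `(P)` (`P, Q ∈ ℂ[X]_D`). [cite: Roy2013, §5, proof of Lemma 5.1] -/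
theorem map_mulLeft_inf_map_mulLeft {P Q : CX} {D : ℕ} (hP : P.IsHomogeneous D)
    (hQ : Q.IsHomogeneous D) (hPQ : ∀ f : CX, Q * f ∈ Ideal.span {P} → f ∈ Ideal.span {P}) :
    (homogeneousSubmodule (Fin 3) ℂ D).map (LinearMap.mulLeft ℂ P) ⊓
        (homogeneousSubmodule (Fin 3) ℂ D).map (LinearMap.mulLeft ℂ Q) =
      ℂ ∙ (P * Q) := by
  apply le_antisymm
  · rintro f ⟨⟨a, ha, rfl⟩, ⟨b, hb, hab⟩⟩
    rw [LinearMap.mulLeft_apply, LinearMap.mulLeft_apply] at hab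
    -- `Q b = P a ∈ (P)`, so `b ∈ (P)`, and `b ∈ ℂ[X]_D` gives `b = c P`
    have hbP : b ∈ Ideal.span {P} :=
      hPQ b (Ideal.mem_span_singleton'.mpr ⟨a, by rw [mul_comm, hab]⟩)
    have hb' := mem_map_mulLeft_of_mem_span_singleton hP le_rfl hb hbP
    rw [Nat.sub_self] at hb'
    obtain ⟨c, hc, hcb⟩ := hb'
    have hc' : c.IsHomogeneous 0 := hc
    rw [← totalDegree_zero_iff_isHomogeneous, totalDegree_eq_zero_iff_eq_C] at hc'
    rw [LinearMap.mulLeft_apply, ← hab, ← hcb, LinearMap.mulLeft_apply, hc']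
    refine Submodule.mem_span_singleton.mpr ⟨coeff 0 c, ?_⟩
    rw [smul_eq_C_mul]; ring
  · rw [Submodule.span_singleton_le_iff_mem]
    exact ⟨⟨Q, hQ, rfl⟩, ⟨P, hP, by rw [LinearMap.mulLeft_apply, mul_comm]⟩⟩

/-- **`dim (P, Q)_{2D} = 2 binom(D+2, 2) - 1`** for forms `P, Q ∈ ℂ[X]_D`, `P ≠ 0`, `Q` a
non-zero-divisor modulo `(P)` (the exact sequence (5.1) in degree `2D`).
[cite: Roy2013, §5, proof of Lemma 5.1] -/
theorem finrank_map_sup_map {P Q : CX} {D : ℕ} (hP : P.IsHomogeneous D) (hQ : Q.IsHomogeneous D)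
    (hP0 : P ≠ 0) (hQ0 : Q ≠ 0) (hPQ : ∀ f : CX, Q * f ∈ Ideal.span {P} → f ∈ Ideal.span {P}) :
    finrank ℂ ↥((homogeneousSubmodule (Fin 3) ℂ D).map (LinearMap.mulLeft ℂ P) ⊔
        (homogeneousSubmodule (Fin 3) ℂ D).map (LinearMap.mulLeft ℂ Q)) + 1 =
      2 * (D + 2).choose 2 := by
  haveI := finite_homogeneousSubmodule_fin_three D
  haveI : FiniteDimensional ℂ ((homogeneousSubmodule (Fin 3) ℂ D).map (LinearMap.mulLeft ℂ P)) :=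
    Module.Finite.map _ _
  haveI : FiniteDimensional ℂ ((homogeneousSubmodule (Fin 3) ℂ D).map (LinearMap.mulLeft ℂ Q)) :=
    Module.Finite.map _ _
  have h := Submodule.finrank_sup_add_finrank_inf_eq
    ((homogeneousSubmodule (Fin 3) ℂ D).map (LinearMap.mulLeft ℂ P))
    ((homogeneousSubmodule (Fin 3) ℂ D).map (LinearMap.mulLeft ℂ Q))
  rw [map_mulLeft_inf_map_mulLeft hP hQ hPQ, finrank_span_singleton (mul_ne_zero hP0 hQ0),
    finrank_map_mulLeft hP0, finrank_map_mulLeft hQ0] at h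
  omega

/-! ### Monomial complements -/

/-- `ℂ[X]_n` is spanned by the monomials of degree `n`. [folklore] -/
theorem mem_span_monomials_of_isHomogeneous {n : ℕ} {f : CX} (hf : f.IsHomogeneous n) :
    f ∈ Submodule.span ℂ ((fun μ => monomial μ (1 : ℂ)) ''
      ((finsuppAntidiag (univ : Finset (Fin 3)) n : Finset (Fin 3 →₀ ℕ)) : Set (Fin 3 →₀ ℕ))) := by
  classical
  rw [f.as_sum]
  refine Submodule.sum_mem _ fun μ hμ => ?_
  have hdeg : μ ∈ finsuppAntidiag (univ : Finset (Fin 3)) n := by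
    rw [mem_finsuppAntidiag]
    refine ⟨?_, by simp⟩
    have h : μ.degree = n := by
      rw [Finsupp.degree_eq_weight_one]; exact hf (mem_support_iff.mp hμ)
    rwa [Finsupp.degree_eq_sum] at h
  rw [← mul_one (coeff μ f), ← smul_eq_mul, ← smul_monomial]
  exact Submodule.smul_mem _ _ (Submodule.subset_span ⟨μ, hdeg, rfl⟩)

/-- **Every subspace `W` of `ℂ[X]_n` has a complement in `ℂ[X]_n` spanned by monomials of degree
`n`** (choose monomials whose images form a basis of `ℂ[X]_n / W`). [folklore] -/
theorem exists_monomial_complement (n : ℕ) (W : Submodule ℂ CX)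
    (hW : W ≤ homogeneousSubmodule (Fin 3) ℂ n) :
    ∃ M : Finset (Fin 3 →₀ ℕ), (∀ μ ∈ M, μ.degree = n) ∧
      Submodule.span ℂ ((fun μ => monomial μ (1 : ℂ)) '' (M : Set (Fin 3 →₀ ℕ))) ⊓ W = ⊥ ∧
      Submodule.span ℂ ((fun μ => monomial μ (1 : ℂ)) '' (M : Set (Fin 3 →₀ ℕ))) ⊔ W =
        homogeneousSubmodule (Fin 3) ℂ n := by
  classical
  set q : CX →ₗ[ℂ] CX ⧸ W := W.mkQ with hq
  set Tn : Finset (Fin 3 →₀ ℕ) := finsuppAntidiag (univ : Finset (Fin 3)) n with hTn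
  have hTn_deg : ∀ μ ∈ Tn, μ.degree = n := fun μ hμ => by
    rw [hTn, mem_finsuppAntidiag] at hμ
    rw [Finsupp.degree_eq_sum]; exact hμ.1
  obtain ⟨b, hb, hspan, hli⟩ := exists_linearIndependent ℂ
    ((fun μ => q (monomial μ (1 : ℂ))) '' (Tn : Set (Fin 3 →₀ ℕ)))
  have hpre : ∀ v ∈ b, ∃ μ ∈ Tn, q (monomial μ (1 : ℂ)) = v := fun v hv => by
    obtain ⟨μ, hμ, rfl⟩ := hb hv; exact ⟨μ, hμ, rfl⟩
  choose! pre hpre hpreq using hpre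
  have hbfin : b.Finite := (Tn.finite_toSet.image _).subset hb
  haveI : Fintype b := hbfin.fintype
  -- the monomials above `b`
  set M : Finset (Fin 3 →₀ ℕ) := (Finset.univ : Finset b).image (fun v : b => pre v.1) with hM
  have hMdeg : ∀ μ ∈ M, μ.degree = n := by
    intro μ hμ
    rw [hM, mem_image] at hμ
    obtain ⟨v, _, rfl⟩ := hμ
    exact hTn_deg _ (hpre v.1 v.2)
  set E : Submodule ℂ CX := Submodule.span ℂ ((fun μ => monomial μ (1 : ℂ)) '' (M : Set (Fin 3 →₀ ℕ)))
    with hE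
  have hEeq : E = Submodule.span ℂ (Set.range (fun v : b => monomial (pre v.1) (1 : ℂ))) := by
    rw [hE]; congr 1; ext x
    constructor
    · rintro ⟨μ, hμ, rfl⟩
      rw [mem_coe, hM, mem_image] at hμ
      obtain ⟨v, _, rfl⟩ := hμ
      exact ⟨v, rfl⟩
    · rintro ⟨v, rfl⟩
      exact ⟨pre v.1, by rw [mem_coe, hM, mem_image]; exact ⟨v, mem_univ _, rfl⟩, rfl⟩
  refine ⟨M, hMdeg, ?_, ?_⟩
  · -- `E ⊓ W = ⊥`
    rw [← hE, eq_bot_iff]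
    intro x hx
    rw [Submodule.mem_inf, hEeq, Submodule.mem_span_range_iff_exists_fun] at hx
    obtain ⟨⟨c, rfl⟩, hxW⟩ := hx
    have hq0 : ∑ i : b, c i • (i : CX ⧸ W) = 0 := by
      have h := (Submodule.Quotient.mk_eq_zero W).mpr hxW
      rw [← Submodule.mkQ_apply, map_sum] at h
      rw [← h]
      refine Finset.sum_congr rfl fun i _ => ?_
      rw [map_smul, Submodule.mkQ_apply]
      change c i • (i : CX ⧸ W) = c i • q (monomial (pre i.1) 1)
      rw [hpreq i.1 i.2]
    have hc : ∀ i, c i = 0 := Fintype.linearIndependent_iff.mp hli c hq0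
    rw [Submodule.mem_bot]
    exact Finset.sum_eq_zero fun i _ => by rw [hc i, zero_smul]
  · -- `E ⊔ W = ℂ[X]_n`
    rw [← hE]
    apply le_antisymm
    · refine sup_le ?_ hW
      rw [hE, Submodule.span_le]
      rintro _ ⟨μ, hμ, rfl⟩
      exact isHomogeneous_monomial _ (hMdeg μ hμ)
    · intro f hf
      -- reduce to monomials of degree `n`
      have hmon : ∀ μ ∈ Tn, monomial μ (1 : ℂ) ∈ E ⊔ W := by
        intro μ hμ
        have h1 : q (monomial μ (1 : ℂ)) ∈ Submodule.span ℂ b := by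
          rw [hspan]; exact Submodule.subset_span ⟨μ, hμ, rfl⟩
        rw [show (b : Set (CX ⧸ W)) = Set.range (Subtype.val : b → CX ⧸ W) from
          Subtype.range_coe.symm, Submodule.mem_span_range_iff_exists_fun] at h1
        obtain ⟨c, hc⟩ := h1
        set e : CX := ∑ i : b, c i • monomial (pre i.1) (1 : ℂ) with he
        have heE : e ∈ E := by
          rw [hEeq]
          exact Submodule.sum_mem _ fun i _ => Submodule.smul_mem _ _
            (Submodule.subset_span ⟨i, rfl⟩)
        have hqe : q e = q (monomial μ (1 : ℂ)) := by
          rw [← hc, he, map_sum]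
          refine Finset.sum_congr rfl fun i _ => ?_
          rw [map_smul, hpreq i.1 i.2]
        have hW' : monomial μ (1 : ℂ) - e ∈ W := by
          rw [← Submodule.ker_mkQ W, LinearMap.mem_ker, map_sub, sub_eq_zero]
          exact hqe.symm
        have : monomial μ (1 : ℂ) = e + (monomial μ (1 : ℂ) - e) := by ring
        rw [this]
        exact Submodule.add_mem_sup heE hW'
      have hf' := mem_span_monomials_of_isHomogeneous hf
      exact (Submodule.span_le.mpr (by rintro _ ⟨μ, hμ, rfl⟩; exact hmon μ hμ)) hf'

end Roy2013

end Literature.NumberTheory.Transcendental
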